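import Summits.ResolutionOfSingularities.ResolutionOfSingularities.Theorems.HilbertSamuelEliminationSigmaMaxModificationsCorridor3SigmaMenuCorners
import Literature.AlgebraicGeometry.Resolution.TransversalHasSNCWith
import HarnessLib

/-!
# [OURS · L1 W4.2] σ-LAYER (P1*) — `Corridor3SigmaBoundaryOnSurface`: the boundary READ ON A REGULAR SURFACE `D̃ ⊆ W` — the snc / normal-crossing
# BRIDGE for PHASE B′ (res-L1-w42-plan-1 RULINGS v3.14-30 (GZ) → -31 (HC) → -32 (HG)), by NAME over the Literature notions

Typer res-type-067 (g12); co-named res-type-001 (`…SigmaSurfacePhaseClosure`, the (c1)–(c3) closure lemmas) and res-lit-6 (CJS Def. 4.1 / Lemma 4.2 match).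
OURS (cell res-hironaka, slot W4.2); NOT statements of H. Hironaka's manuscript [Hironaka2017] nor of [CossartJannsenSaito2020] / [Kollar2007];
AI-typed, weaker than expert review. Helper VOCABULARY = BRIDGE definitions + bookkeeping lemmas, `--supports stmt-ResolutionOfSingularities-19249 --as helper`
(counted 0); NO row is claimed; NO new snc notion is introduced (RULING (HG)).

## The obstruction and the reading (res-type-067 STATUS 2026-08-27T14:05Z)

The Literature notions `HasSNC E` / `HasSNCWith E C` (`Literature…MarkedIdeals`) and `IsTransversalWith Z D B` (`Literature…EmbeddedResolutionExcellentSurfaces`,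
CJS Def. 4.1) ask the CARRIER to have REGULAR local rings at the points concerned; their preservation law
`IsTransversalWith.isStrictNormalCrossingsDivisor_preimage_of_isBlowup` (`Literature…TransversalHasSNCWith`) takes `Scheme.IsRegular Z`. The σ-layer's
`Boundary W := List W.IdealSheafData` (res-L1-type-o1, `…SigmaBoundaryDefs`) lives on the SINGULAR stage `W = X_n`, so «E snc on W» is not an instance of
`HasSNC`. RULING (HC)'s dictionary reads CJS Def. 4.1 ON THE REGULAR SURFACE `D̃` (the (P1) surface, regular after PHASE S; regularity is the tree clause
`IsMenuCentreAt … ∧ Scheme.IsRegular C.subscheme`): the carrier is `D̃` itself, the members are RESTRICTED to `D̃` (`Γ_j := E_j|_D̃`, scheme structure kept,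
so «reduced at q» is visible), and every snc / n.c. statement of PHASE B′ is a Literature statement about the regular scheme `D̃`.

## Contents (namespace `…Theorems.SigmaMaxModificationsCorridor3.Sigma`)

* §1 `Boundary.divisorSet E` (`⋃_j V(E_j)`), `Boundary.restrict E ι` (pull every member back along `ι : D ⟶ W`: `Γ_j = E_j|_D`), `support_of_mem_restrict`,
  `divisorSet_restrict` (`= ι⁻¹(divisorSet E)`), `length_restrict`, `restrict_nil`.
* §2 THE BRIDGE NAMES (abbreviations of Literature notions, no new content): `Boundary.SncOn E ι := HasSNC (E.restrict ι)` («`E|_D` has simple normal crossings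
  on `D`», CJS Def. 4.1 (i)–(iii) read on `D`); `Boundary.IsNCWithOn E ι C := IsTransversalWith D C (divisorSet (E.restrict ι))` («the centre `C ⊆ D` has normal
  crossings with `E|_D`»); `Boundary.divisorSetOn_isSNC E ι := IsStrictNormalCrossingsDivisor D (divisorSet (E.restrict ι))` (the set-level snc of the
  configuration); the NON-N.C. LOCUS `Boundary.ncLocus E ι := {q | ¬ IsTransversalWith D {q} (divisorSet (E.restrict ι))}` (the points of `D` at which the
  configuration `{Γ_j}` is not n.c. — PHASE B′'s work list; (HC): closed, dimension `≤ 1`, missing the prepared cone corners — NOT proved here).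
* §3 THE B′ STEP LAW ON `D` BY NAME: `Boundary.sncOn_preimage_of_isNCWithOn` = `IsTransversalWith.isStrictNormalCrossingsDivisor_preimage_of_isBlowup` read in
  this vocabulary: on a regular Noetherian `D` with `divisorSet (E|_D)` an snc divisor and a closed centre `C` n.c. with it, the blow-up `D' → D` of `C` is
  regular and `π⁻¹(C ∪ divisorSet (E|_D))` is an snc divisor on `D'`. The identification «`D'` = the strict transform of `D̃` inside `Bl_C W` with the
  restricted boundary `(E.next C)|_{D̃'}`» is the W-side glue and is NOT typed here (named in the docstring of §3 for res-type-001 / the (P1) typer).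
-/

noncomputable section

set_option linter.dupNamespace false

open CategoryTheory AlgebraicGeometry TopologicalSpace
open Summit.ResolutionOfSingularities.ResolutionOfSingularities.Theorems.CampaignW42
open Literature.AlgebraicGeometry.Resolution Literature.RingTheory.HilbertSamuel

namespace Summit.ResolutionOfSingularities.ResolutionOfSingularities.Theorems.SigmaMaxModificationsCorridor3.Sigma

universe u

variable {W D : Scheme.{u}}

/-! ## §1. The divisor set of a boundary and its restriction to a subscheme -/

/-- [OURS · L1 W4.2] **THE DIVISOR SET of the boundary**: the union of the members' supports `⋃_j V(E_j)`. NOT a statement of the manuscript. [folklore] -/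
def Boundary.divisorSet (E : Boundary W) : Set W :=
  ⋃ I ∈ E, (I.support : Set W)

/-- Membership. [folklore] -/
theorem Boundary.mem_divisorSet_iff {E : Boundary W} {x : W} : x ∈ E.divisorSet ↔ ∃ I ∈ E, x ∈ (I.support : Set W) := by
  simp [Boundary.divisorSet]

/-- The divisor set is closed. [folklore] -/
theorem Boundary.isClosed_divisorSet (E : Boundary W) : IsClosed E.divisorSet :=
  (List.finite_toSet E).isClosed_biUnion fun I _ => I.support.isClosed

/-- No boundary, empty divisor set. [folklore] -/
@[simp] theorem Boundary.divisorSet_nil : Boundary.divisorSet ([] : Boundary W) = ∅ := by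
  simp [Boundary.divisorSet]

/-- The members through `x` are the members whose support contains `x`: `x ∈ divisorSet E ↔ membersThrough E x ≠ []`. [folklore] -/
theorem Boundary.mem_divisorSet_iff_membersThrough_ne_nil {E : Boundary W} {x : W} :
    x ∈ E.divisorSet ↔ membersThrough E x ≠ [] := by
  rw [Boundary.mem_divisorSet_iff, Ne, List.eq_nil_iff_forall_not_mem]
  simp only [mem_membersThrough_iff, not_and, not_forall, not_not, exists_prop]

/-- [OURS · L1 W4.2] **THE BOUNDARY RESTRICTED ALONG `ι : D ⟶ W`** (for PHASE B′: `D = D̃` the regular (P1) surface, `ι` its closed immersion): every member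
pulled back, `Γ_j := E_j|_D := E_j.comap ι`, in boundary order — scheme structure kept (a restricted member may be non-reduced: (HC) (M1)'s `(m − 1)·C`).
NOT a statement of the manuscript. [folklore] -/
def Boundary.restrict (E : Boundary W) (ι : D ⟶ W) : Boundary D :=
  E.map fun I => I.comap ι

/-- Restriction keeps the number (and order) of members. [folklore] -/
@[simp] theorem Boundary.length_restrict (E : Boundary W) (ι : D ⟶ W) : (E.restrict ι).length = E.length := by
  simp [Boundary.restrict]

/-- Restricting the empty boundary. [folklore] -/
@[simp] theorem Boundary.restrict_nil (ι : D ⟶ W) : Boundary.restrict ([] : Boundary W) ι = [] := rfl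

/-- The support of a restricted member is the preimage of the member's support. [folklore] -/
theorem Boundary.coe_support_comap (I : W.IdealSheafData) (ι : D ⟶ W) :
    ((I.comap ι).support : Set D) = ι.base ⁻¹' (I.support : Set W) := by
  rw [Scheme.IdealSheafData.support_comap]; rfl

/-- **The restricted divisor set is the preimage of the divisor set.** [folklore] -/
theorem Boundary.divisorSet_restrict (E : Boundary W) (ι : D ⟶ W) :
    (E.restrict ι).divisorSet = ι.base ⁻¹' E.divisorSet := by
  ext q
  simp only [Boundary.divisorSet, Boundary.restrict, Set.mem_preimage, Set.mem_iUnion, List.mem_map, exists_prop]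
  constructor
  · rintro ⟨J, ⟨I, hI, rfl⟩, hq⟩
    exact ⟨I, hI, by rwa [Boundary.coe_support_comap] at hq⟩
  · rintro ⟨I, hI, hq⟩
    exact ⟨I.comap ι, ⟨I, hI, rfl⟩, by rwa [Boundary.coe_support_comap]⟩

/-! ## §2. The bridge names (abbreviations of the Literature notions, read on the carrier `D`) -/

/-- [OURS · L1 W4.2 · BRIDGE] **«`E|_D` HAS SIMPLE NORMAL CROSSINGS ON `D`»** := Literature `HasSNC` of the restricted boundary (BGMW Def. 3.1.1 shape = CJS Def. 4.1
(i)–(iii) read on the regular surface: at every `q ∈ D` a regular system of parameters of `𝒪_{D,q}` such that each restricted member through `q` is cut out by ONE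
parameter — in particular reduced and regular at `q` — distinct members by distinct parameters). Meaningful only on a REGULAR `D`. NOT a statement of the
manuscript. [folklore] -/
abbrev Boundary.SncOn (E : Boundary W) (ι : D ⟶ W) : Prop :=
  HasSNC (E.restrict ι)

/-- [OURS · L1 W4.2 · BRIDGE] **«THE CENTRE `C ⊆ D` HAS NORMAL CROSSINGS WITH `E|_D`»** := Literature `IsTransversalWith D C (divisorSet (E|_D))` (CJS Def. 4.1:
a common regular system of parameters for `C` and the boundary at every point of `C`). NOT a statement of the manuscript.
[cite: CossartJannsenSaito2020, Def. 4.1 (p. 49)] -/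
abbrev Boundary.IsNCWithOn (E : Boundary W) (ι : D ⟶ W) (C : Set D) : Prop :=
  IsTransversalWith D C (E.restrict ι).divisorSet

/-- [OURS · L1 W4.2 · BRIDGE] the set-level snc of the restricted configuration: Literature `IsStrictNormalCrossingsDivisor D (divisorSet (E|_D))`.
NOT a statement of the manuscript. [folklore] -/
abbrev Boundary.DivisorSetSncOn (E : Boundary W) (ι : D ⟶ W) : Prop :=
  IsStrictNormalCrossingsDivisor D (E.restrict ι).divisorSet

/-- [OURS · L1 W4.2] **THE NON-NORMAL-CROSSING LOCUS `NC(D, E)`** — PHASE B′'s work list: the points `q` of `D` at which the point `{q}` is NOT n.c. with the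
restricted configuration (equivalently: no regular system of parameters at `q` adapted to the members through `q`). (HC): closed, of dimension `≤ 1`,
disjoint from the prepared cone corners — NOT proved here. NOT a statement of the manuscript. [folklore] -/
def Boundary.ncLocus (E : Boundary W) (ι : D ⟶ W) : Set D :=
  {q | ¬ E.IsNCWithOn ι {q}}

/-- Off the restricted divisor set every REGULAR point is n.c. (the `J = ∅` case of CJS Def. 4.1): so `NC(D, E) ⊆ divisorSet (E|_D)` on a regular `D` —
stated as the contrapositive clause the (P1) typer discharges with the local regularity datum. [folklore] -/
theorem Boundary.ncLocus_subset_of {E : Boundary W} {ι : D ⟶ W}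
    (h : ∀ q : D, q ∉ (E.restrict ι).divisorSet → E.IsNCWithOn ι {q}) : E.ncLocus ι ⊆ (E.restrict ι).divisorSet :=
  fun q hq => by_contra fun hq' => hq (h q hq')

/-! ## §3. The PHASE B′ step law on the regular surface, BY NAME -/

/-- [OURS · L1 W4.2 · BRIDGE] **THE B′ STEP LAW ON `D` (Literature `IsTransversalWith.isStrictNormalCrossingsDivisor_preimage_of_isBlowup` in boundary
vocabulary):** on a regular Noetherian `D`, if the restricted configuration `divisorSet (E|_D)` is an snc divisor and the closed centre `C ⊆ D` has normal
crossings with it, then the blow-up `D' → D` of `C` is REGULAR and `π⁻¹(C ∪ divisorSet (E|_D))` is an snc divisor on `D'` — i.e. after the step the new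
configuration «strict transforms of the `Γ_j` + the exceptional curve» is again snc ON THE NEW SURFACE. The W-side identification («`D'` is the strict transform
of `D̃` in `Bl_C W` and `π⁻¹(C ∪ divisorSet (E|_D)) = divisorSet ((E.next C_W)|_{D̃'})`») is the (P1) typer's glue and is not asserted here.
[cite: CossartJannsenSaito2020, Lemma 4.2] [cite: Kollar2007, Def. 3.25] -/
theorem Boundary.sncOn_preimage_of_isNCWithOn [IsNoetherian D] {D' : Scheme.{u}} {π : D' ⟶ D} (hD : Scheme.IsRegular D)
    {E : Boundary W} {ι : D ⟶ W} {C : Set D} (hC : IsClosed C) (hB : E.DivisorSetSncOn ι) (hNC : E.IsNCWithOn ι C)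
    (hπ : IsBlowup π (Scheme.IdealSheafData.vanishingIdeal ⟨C, hC⟩)) :
    Scheme.IsRegular D' ∧ IsStrictNormalCrossingsDivisor D' (π.base ⁻¹' (C ∪ (E.restrict ι).divisorSet)) :=
  hNC.isStrictNormalCrossingsDivisor_preimage_of_isBlowup hD hC hB hπ

end Summit.ResolutionOfSingularities.ResolutionOfSingularities.Theorems.SigmaMaxModificationsCorridor3.Sigma

end
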